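import Summits.NavierStokesRegularity.FluidComputer.RiccatiInequality
import Summits.NavierStokesRegularity.FluidComputer.RiccatiComparison
import Summits.NavierStokesRegularity.FluidComputer.LerayFrontClock
import Summits.NavierStokesRegularity.FluidComputer.SobolevLadderFront
import Summits.NavierStokesRegularity.NavierStokesRegularity.Theorems.FluidComputerCascade
import HarnessLib

/-!
# Fluid computer — L56: the OPTIMAL `Ḃ^{3/2}_{2,2}` row (Cheskidov–Zaya 2016): `∑_j 8^j ‖Δ̇_j u(t)‖₂² ≥ ν/(K(T − t))`

HONEST FRAMING (cell `pub-fluidc`, verbatim): *low prior, high value-of-information experiment on Tao's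
machine paradigm; NOT a claim that NS blows up.* Theorem side of the cell (the level dictionary); nothing here is
evidence of blow-up — these are necessities obeyed by EVERY maximal smooth finite-energy solution on `ℝ³`.

The dictionary's rows L51/L52 (`SobolevLadder`, `HomSobolevLadder`) give the scaling-sharp blow-up rates of the
`Ḃ^s_{2,1}` / `Ḣ^s` currencies for `1/2 < s < 3/2` and of `Ḃ^{3/2}_{2,1}` (ℓ¹ over the levels); L53/L54 give NON-optimal
rates above `3/2`. The endpoint `s = 3/2` in the ℓ² (Hilbert) currency `∑_j 8^j ‖Δ̇_j u‖₂² ≃ ‖u‖²_{Ḣ^{3/2}}` is the row of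
Cheskidov–Zaya 2016 (Thm. 2.4: `‖u(t)‖_{Ḣ^{3/2}} ≥ c √(ν/(T* − t))`, OPTIMAL), obtained not by interpolation but from the
RICCATI law `y' ≲ ν⁻¹ y²` of the row (their Thm. 2.2). This file closes it in the tree's dyadic currency:

* `besov32_clock` (**L56 — THE OPTIMAL `Ḃ^{3/2}_{2,2}` ROW**) — there is an absolute `K > 0` such that along every
  maximal smooth solution `(u, p)` of the unforced Navier–Stokes system on `ℝ³ × [0, T)` (`ν > 0`) which is Leray–Hopf
  from `u 0`, at EVERY `t ∈ (0, T)`: `ν/(K (T − t)) ≤ ∑_{j∈ℤ} 8^j ‖Δ̇_j u(t)‖₂²`. NO energy factor, exponent `−1`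
  (scaling-sharp AND rate-optimal). Proof: the integrated Riccati inequality `Y(t) − Y(s) ≤ (K/ν)∫_s^t Y²`
  (`RiccatiInequality.besov32_two_point`), the comparison `RiccatiComparison.mul_le_of_sq` run from `t` on `Y + ε`,
  and the divergence of `Y` at `T` (the dyadic enstrophy clock L20 `LerayFrontClock.dyadicF_clock` + the fixed-level
  bookkeeping `dyadicF_le_head_add_tail`: `F ≤ 8‖u(0)‖₂² + Y`): were `K Y(t)(T − t) < ν`, `Y` would stay bounded up to `T`.
* `besov32_clock_rpow`, `besov32_tendsto_top` — the same in the ladder's format `K⁻¹ ν (T − t)^{−1} ≤ Y(t)` and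
  `Y(t) → ∞` as `t ↑ T`;
* `besov32_clock_of_cascadeWitness` — read on the cell's interface (`CascadeWitness`).

0 sorry; no definitions; no named facts (inputs: `besov32_two_point`, `mul_le_of_sq`, `dyadicF_clock`,
`dyadicF_le_head_add_tail`, `continuousOn_besov32`, `besov32_ne_top`, `x5a_of_cascadeWitness'`).

## References

* A. Cheskidov, K. Zaya, *Lower bounds of potential blow-up solutions of the three-dimensional Navier–Stokes
  equations in Ḣ^{3/2}*, J. Math. Phys. 57 (2016) 023101 = arXiv:1503.01784, Thm. 2.2, Thm. 2.4 (pp. 5–6).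
  [CheskidovZaya2016]
* J. C. Robinson, W. Sadowski, R. P. Silva, J. Math. Phys. 53 (2012) 115618 (context: optimal rates for `s < 5/2`, `s ≠ 3/2`).
  [RobinsonSadowskiSilva2012]
-/

noncomputable section

open MeasureTheory Set Function Filter Topology
open scoped ENNReal NNReal
open Literature.Analysis.FluidPDE Literature.Analysis.FunctionSpaces
open Literature.Analysis.FluidPDE.FluidComputer
open Summit.NavierStokesRegularity.NavierStokesRegularity.Theorems.FluidComputer (x5a_of_cascadeWitness')
open Summit.NavierStokesRegularity.FluidComputer.BlockEnergyTransport
open Summit.NavierStokesRegularity.FluidComputer.RiccatiInequality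
open Summit.NavierStokesRegularity.FluidComputer.RiccatiComparison
open Summit.NavierStokesRegularity.FluidComputer.LerayFrontClock
open Summit.NavierStokesRegularity.FluidComputer.SobolevLadderFront (tendsto_ofReal_clock_top)

namespace Summit.NavierStokesRegularity.FluidComputer.Besov32Clock

/-! ## Divergence of the row at the lifespan (qualitative, from the enstrophy clock) -/

/-- **The `Ḃ^{3/2}_{2,2}` row is unbounded on every terminal window.** Along a maximal smooth Leray–Hopf solution of
the unforced system (`ν > 0`), for every `t₀ < T` and every real `M` there is `b ∈ (t₀, T) ∩ (0, T)` with
`M < ∑_j 8^j ‖Δ̇_j u(b)‖₂²` (finite there). The dyadic enstrophy `F = ∑_l 4^l a_l²` obeys the clock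
`c ν³ ≤ (6 C_b² F(u(b)))² (T − b)` (L20, `dyadicF_clock`) and `F ≤ 8‖u(0)‖₂² + ∑_{n≥0} 4^n a_n² ≤ 8‖u(0)‖₂² + Y`
(`dyadicF_le_head_add_tail` at level `0`), so `Y(b) → ∞` as `b ↑ T`. [cite: CheskidovZaya2016, Thm. 2.4 (proof)]
[cite: RobinsonRodrigoSadowski2016, Lemma 6.11] -/
theorem exists_besov32_gt {ν T : ℝ} (hν : 0 < ν) (hT : 0 < T)
    {u : ℝ → EuclideanSpace ℝ (Fin 3) → EuclideanSpace ℝ (Fin 3)} {p : ℝ → EuclideanSpace ℝ (Fin 3) → ℝ}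
    (hmax : IsMaximalSmoothSolution ν 0 u p T) (hLH : IsLerayHopfOn T ν 0 (u 0) u)
    {t₀ : ℝ} (ht₀ : t₀ < T) (M : ℝ) :
    ∃ b ∈ Ioo (max t₀ 0) T,
      M < (∑' j : ℤ, (2 : ℝ≥0∞) ^ ((3 : ℝ) * (j : ℝ)) * blockL2 (u b) j ^ 2).toReal := by
  obtain ⟨c, hc, H⟩ := dyadicF_clock
  set K := lpBounds (Fin 3) with hK
  have hu0 : MemLp (u 0) 2 volume := hLH.memLp 0 ⟨le_rfl, hT.le⟩
  -- the constant bounding the low levels and the target level `M`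
  set E' : ℝ≥0∞ := 8 * eLpNorm (u 0) 2 volume ^ 2 with hE'
  have hE'top : E' ≠ ∞ := ENNReal.mul_ne_top (by norm_num) (ENNReal.pow_ne_top hu0.eLpNorm_ne_top)
  set M' : ℝ≥0∞ := ENNReal.ofReal M with hM'
  set Qe : ℝ≥0∞ := (6 * (K.Cb : ℝ≥0∞) ^ 2 * (E' + M')) ^ 2 with hQe
  have hQetop : Qe ≠ ∞ := ENNReal.pow_ne_top (ENNReal.mul_ne_top
    (ENNReal.mul_ne_top (by norm_num) (ENNReal.pow_ne_top ENNReal.coe_ne_top))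
    (ENNReal.add_ne_top.2 ⟨hE'top, ENNReal.ofReal_ne_top⟩))
  set Q : ℝ := Qe.toReal with hQ
  have hQ0 : 0 ≤ Q := ENNReal.toReal_nonneg
  -- a time `b` close to `T` with `Q (T - b) < c ν³`
  set t₁ : ℝ := max t₀ 0 with ht₁
  have ht₁T : t₁ < T := max_lt ht₀ hT
  set d : ℝ := min ((T - t₁) / 2) (c * ν ^ 3 / (2 * (Q + 1))) with hd
  have hd0 : 0 < d := lt_min (by linarith) (by positivity)
  have hd1 : d ≤ (T - t₁) / 2 := min_le_left _ _
  have hd2 : d ≤ c * ν ^ 3 / (2 * (Q + 1)) := min_le_right _ _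
  set b : ℝ := T - d with hb
  have hbI : b ∈ Ioo t₁ T := ⟨by linarith, by linarith⟩
  have hb0T : b ∈ Ioo 0 T := ⟨(le_max_right t₀ 0).trans_lt hbI.1, hbI.2⟩
  have hsmall : Q * (T - b) < c * ν ^ 3 := by
    have hTb : T - b = d := by rw [hb]; ring
    rw [hTb]
    have h1 : Q * d ≤ Q * (c * ν ^ 3 / (2 * (Q + 1))) := mul_le_mul_of_nonneg_left hd2 hQ0
    have h2 : Q * (c * ν ^ 3 / (2 * (Q + 1))) < c * ν ^ 3 := by
      rw [mul_div_assoc']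
      rw [div_lt_iff₀ (by positivity)]
      nlinarith [mul_pos hc (pow_pos hν 3)]
    linarith
  refine ⟨b, hbI, ?_⟩
  -- at `b` the row exceeds `M`
  set y : ℝ≥0∞ := ∑' j : ℤ, (2 : ℝ≥0∞) ^ ((3 : ℝ) * (j : ℝ)) * blockL2 (u b) j ^ 2 with hy
  have hytop : y ≠ ∞ := besov32_ne_top hν hT hmax hLH hb0T
  have hFle : dyadicF (u b) ≤ E' + y := by
    have h := dyadicF_le_head_add_tail hν hT hLH ⟨hb0T.1.le, hb0T.2⟩ 0
    simp only [mul_zero, pow_zero, mul_one, zero_add] at h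
    refine h.trans (add_le_add le_rfl ?_)
    calc ∑' n : ℕ, (2 : ℝ≥0∞) ^ (2 * n) * blockL2 (u b) (n : ℤ) ^ 2
        ≤ ∑' n : ℕ, (2 : ℝ≥0∞) ^ ((3 : ℝ) * (((n : ℤ)) : ℝ)) * blockL2 (u b) (n : ℤ) ^ 2 := by
          refine ENNReal.tsum_le_tsum fun n => mul_le_mul' ?_ le_rfl
          rw [show ((3 : ℝ) * (((n : ℤ)) : ℝ)) = ((3 * n : ℕ) : ℝ) by push_cast; ring, ENNReal.rpow_natCast]
          exact pow_le_pow_right₀ one_le_two (by omega)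
      _ ≤ y := ENNReal.tsum_comp_le_tsum_of_injective Nat.cast_injective
          (fun j : ℤ => (2 : ℝ≥0∞) ^ ((3 : ℝ) * (j : ℝ)) * blockL2 (u b) j ^ 2)
  by_contra hle
  push Not at hle
  -- then `y ≤ M'`, `F(u b) ≤ E' + M'`, and the clock fails
  have hyM : y ≤ M' := by
    rw [hM', ← ENNReal.ofReal_toReal hytop]
    exact ENNReal.ofReal_le_ofReal hle
  have hclock := H ν T hν hT u p hmax hLH b hb0T
  have hQle : (6 * (K.Cb : ℝ≥0∞) ^ 2 * dyadicF (u b)) ^ 2 * ENNReal.ofReal (T - b) ≤ Qe * ENNReal.ofReal (T - b) := by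
    rw [hQe]
    gcongr
    exact hFle.trans (add_le_add le_rfl hyM)
  have hQe' : Qe * ENNReal.ofReal (T - b) = ENNReal.ofReal (Q * (T - b)) := by
    rw [ENNReal.ofReal_mul hQ0, hQ, ENNReal.ofReal_toReal hQetop]
  have h := (hclock.trans hQle).trans_eq hQe'
  rw [ENNReal.ofReal_le_ofReal_iff (mul_nonneg hQ0 (by linarith [hb0T.2]))] at h
  linarith

/-! ## L56 — the optimal row -/

/-- **L56 — THE OPTIMAL `Ḃ^{3/2}_{2,2}` ROW (Cheskidov–Zaya 2016, Thm. 2.4, in the tree's dyadic currency).** There is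
an absolute constant `K > 0` such that for every `ν > 0`, `T > 0`, every maximal smooth solution `(u, p)` of the
unforced Navier–Stokes system on `ℝ³ × [0, T)` (classical on `[0, T)`, no classical continuation past `T`) which is a
Leray–Hopf weak solution from `u 0`, and EVERY `t ∈ (0, T)`:
`ν / (K (T − t)) ≤ ∑_{j∈ℤ} 8^j ‖Δ̇_j u(t)‖₂²`
— the `Ḃ^{3/2}_{2,2}` row (`≃ ‖u(t)‖²_{Ḣ^{3/2}}`) blows up at least like `(T − t)^{−1}`, with NO dependence on the energy:
the scaling-sharp AND rate-optimal endpoint `s = 3/2` of the Sobolev ladder, which interpolation (L51/L52) reaches only in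
the weaker ℓ¹ currency. Proof (their Thm. 2.2 ⇒ Thm. 2.4): `Y(b) − Y(t) ≤ (K/ν)∫_t^b Y²` along `(0, T)`
(`RiccatiInequality.besov32_two_point`); if `K (Y(t)+ε)(T − t) < ν` the Bernoulli comparison
`RiccatiComparison.mul_le_of_sq` (applied to `Y(t + ·) + ε`, continuous by `continuousOn_besov32`) keeps `Y` bounded on
`[t, T)`, contradicting `exists_besov32_gt`; hence `K (Y(t)+ε)(T − t) ≥ ν` for every `ε > 0`. In cascade words: at
every instant the levels' `8^j`-weighted energies must already sum to `ν/(K(T−t))` — a countdown that no design can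
beat by storing energy low and moving it up late. Necessity only. [cite: CheskidovZaya2016, Thm. 2.2, Thm. 2.4 (pp. 5–6)] -/
theorem besov32_clock :
    ∃ K : ℝ, 0 < K ∧ ∀ (ν T : ℝ), 0 < ν → 0 < T →
      ∀ (u : ℝ → EuclideanSpace ℝ (Fin 3) → EuclideanSpace ℝ (Fin 3)) (p : ℝ → EuclideanSpace ℝ (Fin 3) → ℝ),
      IsMaximalSmoothSolution ν 0 u p T → IsLerayHopfOn T ν 0 (u 0) u →
      ∀ t ∈ Ioo 0 T,
        ENNReal.ofReal (ν / (K * (T - t))) ≤ ∑' j : ℤ, (2 : ℝ≥0∞) ^ ((3 : ℝ) * (j : ℝ)) * blockL2 (u t) j ^ 2 := by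
  obtain ⟨K, hK, hRic⟩ := besov32_two_point
  refine ⟨K, hK, fun ν T hν hT u p hmax hLH t₀ ht₀ => ?_⟩
  set Y : ℝ → ℝ := fun τ => (∑' j : ℤ, (2 : ℝ≥0∞) ^ ((3 : ℝ) * (j : ℝ)) * blockL2 (u τ) j ^ 2).toReal with hY
  have hY0 : ∀ τ, 0 ≤ Y τ := fun τ => ENNReal.toReal_nonneg
  set Lr : ℝ := K / ν with hLr
  have hLr0 : 0 < Lr := div_pos hK hν
  -- the key claim: for every `ε > 0`, `1 ≤ Lr (Y t₀ + ε) (T - t₀)`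
  have hclaim : ∀ ε : ℝ, 0 < ε → 1 ≤ Lr * (Y t₀ + ε) * (T - t₀) := by
    intro ε hε
    by_contra hlt
    push Not at hlt
    set A : ℝ := Y t₀ + ε with hA
    have hA0 : 0 < A := by have := hY0 t₀; linarith
    set θ : ℝ := 1 - Lr * A * (T - t₀) with hθ
    have hθ0 : 0 < θ := by linarith
    obtain ⟨b, hb, hMb⟩ := exists_besov32_gt hν hT hmax hLH ht₀.2 (A / θ)
    have hb1 : t₀ < b := (le_max_left t₀ 0).trans_lt hb.1
    have hbT : b < T := hb.2
    -- continuity of `Y` on `[t₀, b]` and the shifted function `G`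
    have hYc : ContinuousOn Y (Icc t₀ b) := continuousOn_besov32 hν hT hmax hLH ht₀.1 hb1.le hbT
    set G : ℝ → ℝ := fun τ => Y (t₀ + τ) + ε with hG
    have hmaps : MapsTo (fun τ : ℝ => t₀ + τ) (Icc 0 (b - t₀)) (Icc t₀ b) := fun τ hτ =>
      ⟨by linarith [hτ.1], by linarith [hτ.2]⟩
    have hGc : ContinuousOn G (Icc 0 (b - t₀)) :=
      ((hYc.comp (continuous_const.add continuous_id).continuousOn hmaps).add continuousOn_const)
    have hGsqc : ∀ b' ∈ Icc 0 (b - t₀), ContinuousOn (fun τ => G τ ^ 2) (uIcc 0 b') := fun b' hb' => by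
      rw [uIcc_of_le hb'.1]
      exact (hGc.mono (Icc_subset_Icc le_rfl hb'.2)).pow 2
    have hYsqc : ∀ b' ∈ Icc 0 (b - t₀), ContinuousOn (fun τ => Y (t₀ + τ) ^ 2) (uIcc 0 b') := fun b' hb' => by
      rw [uIcc_of_le hb'.1]
      exact ((hYc.comp (continuous_const.add continuous_id).continuousOn hmaps).mono
        (Icc_subset_Icc le_rfl hb'.2)).pow 2
    have hG0 : ∀ τ ∈ Icc 0 (b - t₀), 0 ≤ G τ := fun τ _ => by have := hY0 (t₀ + τ); simp only [hG]; linarith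
    have hpos : 0 < G 0 := by simp only [hG, add_zero]; exact hA0
    -- the integral inequality for `G` from the two-point Riccati inequality
    have hineq : ∀ b' ∈ Icc 0 (b - t₀), G b' ≤ G 0 + Lr * ∫ τ in (0 : ℝ)..b', G τ ^ 2 := by
      intro b' hb'
      have h2 := hRic ν T hν hT u p hmax hLH t₀ (t₀ + b') ht₀.1 (by linarith [hb'.1]) (by linarith [hb'.2])
      have hshift : ∫ τ in t₀..(t₀ + b'), Y τ ^ 2 = ∫ τ in (0 : ℝ)..b', Y (t₀ + τ) ^ 2 := by
        rw [intervalIntegral.integral_comp_add_left (fun τ => Y τ ^ 2) t₀, add_zero]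
      have hmono : ∫ τ in (0 : ℝ)..b', Y (t₀ + τ) ^ 2 ≤ ∫ τ in (0 : ℝ)..b', G τ ^ 2 := by
        refine intervalIntegral.integral_mono_on hb'.1 (hYsqc b' hb').intervalIntegrable
          (hGsqc b' hb').intervalIntegrable fun τ _ => ?_
        have h0 := hY0 (t₀ + τ)
        simp only [hG]
        nlinarith
      have h3 : Y (t₀ + b') - Y t₀ ≤ Lr * ∫ τ in (0 : ℝ)..b', G τ ^ 2 := by
        rw [hLr]
        calc Y (t₀ + b') - Y t₀ ≤ K / ν * ∫ τ in t₀..(t₀ + b'), Y τ ^ 2 := h2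
          _ ≤ K / ν * ∫ τ in (0 : ℝ)..b', G τ ^ 2 := by
              rw [hshift]
              exact mul_le_mul_of_nonneg_left hmono (div_pos hK hν).le
      simp only [hG, add_zero]
      linarith
    have hcomp := mul_le_of_sq hLr0.le (by linarith : 0 < b - t₀) hGc hG0 hpos hineq (b - t₀)
      ⟨by linarith, le_rfl⟩
    simp only [hG, add_zero, add_sub_cancel] at hcomp
    -- `1 - Lr A (b - t₀) ≥ θ > 0`, hence `Y b + ε ≤ A / θ`
    have hφ : θ ≤ 1 - Lr * (Y t₀ + ε) * (b - t₀) := by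
      have : Lr * A * (b - t₀) ≤ Lr * A * (T - t₀) := by
        refine mul_le_mul_of_nonneg_left (by linarith) (mul_nonneg hLr0.le hA0.le)
      rw [hθ, hA]; linarith
    have h4 : (Y b + ε) * θ ≤ A := by
      have hYb := hY0 b
      calc (Y b + ε) * θ ≤ (Y b + ε) * (1 - Lr * (Y t₀ + ε) * (b - t₀)) :=
            mul_le_mul_of_nonneg_left hφ (by linarith)
        _ ≤ Y t₀ + ε := hcomp
        _ = A := rfl
    have h5 : Y b + ε ≤ A / θ := (le_div_iff₀ hθ0).2 h4
    linarith
  -- let `ε → 0`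
  have hmain : 1 ≤ Lr * Y t₀ * (T - t₀) := by
    by_contra hlt
    push Not at hlt
    have hTt : 0 < T - t₀ := sub_pos.2 ht₀.2
    set ε : ℝ := (1 - Lr * Y t₀ * (T - t₀)) / (2 * (Lr * (T - t₀))) with hε
    have hε0 : 0 < ε := div_pos (by linarith) (by positivity)
    have h := hclaim ε hε0
    have hcalc : Lr * (Y t₀ + ε) * (T - t₀) = Lr * Y t₀ * (T - t₀) + (1 - Lr * Y t₀ * (T - t₀)) / 2 := by
      rw [hε]
      field_simp
    linarith
  -- conclude
  have hYt : ν / (K * (T - t₀)) ≤ Y t₀ := by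
    have hTt : 0 < T - t₀ := sub_pos.2 ht₀.2
    rw [div_le_iff₀ (by positivity)]
    rw [hLr] at hmain
    have : 1 * ν ≤ K / ν * Y t₀ * (T - t₀) * ν := mul_le_mul_of_nonneg_right hmain hν.le
    calc ν = 1 * ν := (one_mul ν).symm
      _ ≤ K / ν * Y t₀ * (T - t₀) * ν := this
      _ = Y t₀ * (K * (T - t₀)) := by field_simp
  calc ENNReal.ofReal (ν / (K * (T - t₀))) ≤ ENNReal.ofReal (Y t₀) := ENNReal.ofReal_le_ofReal hYt
    _ = _ := ENNReal.ofReal_toReal (besov32_ne_top hν hT hmax hLH ht₀)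

/-! ## The ladder format, divergence, and the interface reading -/

/-- **L56 in the ladder's format**: with the constant `K` of `besov32_clock`,
`K⁻¹ · ν^1 · (T − t)^{−1} ≤ ∑_j 8^j ‖Δ̇_j u(t)‖₂²` at every `t ∈ (0, T)` — the row `s = 3/2` of the Sobolev ladder
(L51/L52 have `c_s ν^{(5−2s)/4}(T−t)^{−(2s−1)/4}` for the NORMS; squared at `s = 3/2`: `ν (T−t)^{−1}`) in the Hilbert
currency, where the ℓ¹ row L51 (`SobolevLadder`) and interpolation stop. [cite: CheskidovZaya2016, Thm. 2.4] -/
theorem besov32_clock_rpow :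
    ∃ c : ℝ, 0 < c ∧ ∀ (ν T : ℝ), 0 < ν → 0 < T →
      ∀ (u : ℝ → EuclideanSpace ℝ (Fin 3) → EuclideanSpace ℝ (Fin 3)) (p : ℝ → EuclideanSpace ℝ (Fin 3) → ℝ),
      IsMaximalSmoothSolution ν 0 u p T → IsLerayHopfOn T ν 0 (u 0) u →
      ∀ t ∈ Ioo 0 T,
        ENNReal.ofReal (c * ν ^ (1 : ℝ) * (T - t) ^ (-(1 : ℝ))) ≤
          ∑' j : ℤ, (2 : ℝ≥0∞) ^ ((3 : ℝ) * (j : ℝ)) * blockL2 (u t) j ^ 2 := by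
  obtain ⟨K, hK, H⟩ := besov32_clock
  refine ⟨K⁻¹, inv_pos.2 hK, fun ν T hν hT u p hmax hLH t ht => ?_⟩
  have hTt : 0 < T - t := sub_pos.2 ht.2
  have e : K⁻¹ * ν ^ (1 : ℝ) * (T - t) ^ (-(1 : ℝ)) = ν / (K * (T - t)) := by
    rw [Real.rpow_one, Real.rpow_neg hTt.le, Real.rpow_one]
    field_simp
  rw [e]
  exact H ν T hν hT u p hmax hLH t ht

/-- **L56′ — THE `Ḃ^{3/2}_{2,2}` ROW DIVERGES AT THE LIFESPAN WITH THE OPTIMAL RATE**: along every maximal smooth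
Leray–Hopf solution of the unforced system (`ν > 0`), `∑_j 8^j ‖Δ̇_j u(t)‖₂² → ∞` as `t ↑ T` (from `besov32_clock_rpow`).
[cite: CheskidovZaya2016, Thm. 2.4] -/
theorem besov32_tendsto_top {ν T : ℝ} (hν : 0 < ν) (hT : 0 < T)
    {u : ℝ → EuclideanSpace ℝ (Fin 3) → EuclideanSpace ℝ (Fin 3)} {p : ℝ → EuclideanSpace ℝ (Fin 3) → ℝ}
    (hmax : IsMaximalSmoothSolution ν 0 u p T) (hLH : IsLerayHopfOn T ν 0 (u 0) u) :
    Tendsto (fun t => ∑' j : ℤ, (2 : ℝ≥0∞) ^ ((3 : ℝ) * (j : ℝ)) * blockL2 (u t) j ^ 2) (𝓝[<] T) (𝓝 ∞) := by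
  obtain ⟨c, hc, H⟩ := besov32_clock_rpow
  refine tendsto_nhds_top_mono (tendsto_ofReal_clock_top (a := (1 : ℝ)) (T := T) hc hν one_pos) ?_
  filter_upwards [Ioo_mem_nhdsLT hT] with t ht
  exact H ν T hν hT u p hmax hLH t ht

/-- **L56 READ ON THE INTERFACE: every cascade witness carries the optimal `Ḃ^{3/2}_{2,2}` countdown.** Every
`W : CascadeWitness` yields `ν > 0`, `T > 0` and a maximal smooth solution `(u, p)` of the unforced Navier–Stokes system
on `ℝ³ × [0, T)`, Leray–Hopf from `u 0` (`x5a_of_cascadeWitness'`), such that, with the absolute constant `K` of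
`besov32_clock`: `ν/(K(T − t)) ≤ ∑_j 8^j ‖Δ̇_j u(t)‖₂²` at every `t ∈ (0, T)`, and the row tends to `∞` as `t ↑ T`.
A cascade design read through the interface must therefore hold, at EVERY instant `t`, a total `8^j`-weighted level
energy of at least `ν/(K(T−t))` — independently of its energy budget. [cite: CheskidovZaya2016, Thm. 2.4] -/
theorem besov32_clock_of_cascadeWitness (W : CascadeWitness) :
    ∃ ν : ℝ, 0 < ν ∧ ∃ T : ℝ, 0 < T ∧
      ∃ (u : ℝ → EuclideanSpace ℝ (Fin 3) → EuclideanSpace ℝ (Fin 3)) (p : ℝ → EuclideanSpace ℝ (Fin 3) → ℝ),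
        IsMaximalSmoothSolution ν 0 u p T ∧ IsLerayHopfOn T ν 0 (u 0) u ∧
        (∀ t ∈ Ioo 0 T, ENNReal.ofReal (ν / (besov32_clock.choose * (T - t))) ≤
            ∑' j : ℤ, (2 : ℝ≥0∞) ^ ((3 : ℝ) * (j : ℝ)) * blockL2 (u t) j ^ 2) ∧
        Tendsto (fun t => ∑' j : ℤ, (2 : ℝ≥0∞) ^ ((3 : ℝ) * (j : ℝ)) * blockL2 (u t) j ^ 2) (𝓝[<] T) (𝓝 ∞) := by
  obtain ⟨ν, hν, T, hT, u, p, hmax, hLH, -⟩ := x5a_of_cascadeWitness' W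
  exact ⟨ν, hν, T, hT, u, p, hmax, hLH, besov32_clock.choose_spec.2 ν T hν hT u p hmax hLH,
    besov32_tendsto_top hν hT hmax hLH⟩

end Summit.NavierStokesRegularity.FluidComputer.Besov32Clock

end
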